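import Summits.Ventures.HSemireg.WedgeHankelRecurrenceTorelli
import Mathlib.LinearAlgebra.Projectivization.Cardinality

/-!
# Venture HSemireg — COUNTING OVER A FINITE FIELD: for `2r ≤ N + 1` the minimal-recurrence lines of the classes of middle rank `r` are the points of the projective space
# `P(K[X]_{≤ r})` (N26), so over a finite field `K` with `|K| = s` **there are exactly `1 + s + ⋯ + s^r = |P^r(K)|` of them, and — throughout the window `r ≤ k ≤ N + 1 − r` — exactly
# as many distinct degree-`k` kernels `Kr(univ, w_N(q), k)` of rank-`r` classes** (N27's Torelli)

HONEST FRAMING. Part of the Lean index of the computation cell `pub-hsemireg` (seat p10 gen 27, Sunday typer «UNIFORM-IN-n»).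
LINEAR ALGEBRA OF HANKEL (catalecticant) MATRICES and of polynomials over a field + (through the cited tree theorems) finite-dimensional EXTERIOR ALGEBRA ONLY; the count is Mathlib's
`Projectivization.card_of_finrank`.  No variety, no cohomology theory, no sheaf, no Ext group and no semiregularity map is constructed here; nothing here says that HC / HC_CM / HC_AV holds;
no Literature fact is declared or used.  Custodian versions as in `WedgeHankelSiegelIdeal` (1/3); the dictionary (`Kr(univ, w_N(q), k)` = the degree-`k` kernel of `θ ↦ θ ∧ w_N(q)`; a line
`K · p₀ ⊆ K[X]_{≤ r}` = a point of `P^r = Sym^r(P¹)` = an effective divisor of degree `r` on `P¹`) is QUOTED, never asserted.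

WHAT IS IN THE TREE.  N26 (`WedgeHankelRecurrenceModuli`, № 179): `setOf_recSpace_self_eq` (the minimal-recurrence lines of the rank-`r` classes are exactly the lines of `K[X]_{≤ r}`);
N27 (`WedgeHankelRecurrenceTorelli`, № 218): `Kr_w_eq_Kr_w_iff_recSpace_self_eq` (in the window the degree-`k` kernel and the minimal-recurrence line determine each other); N18 (№ 173):
`finrank_polynomial_degreeLT`, `mem_degreeLT_succ_iff`.  Mathlib: `Projectivization` (`mk`, `submodule`, `submodule_mk`, `submodule_injective`, `ind`), **`Projectivization.card_of_finrank`**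
(`|P(V)| = Σ_{i < n} |K|^i` for `finrank V = n`, `K` finite), `Set.ncard_range_of_injective`, `Set.ncard_congr`, `Submodule.map_injective_of_injective`, `Submodule.map_span`.
THIS FILE (namespace `Summit.Ventures.HSemireg.Wedge.HankelOuter` continued; PLAIN over the tree + one Mathlib import; 0 definitions):
* §520 `setOf_span_singleton_eq_range` (the lines `K · p₀`, `p₀ ≠ 0`, `deg p₀ ≤ r`, are the images of the points of `P(K[X]_{≤ r})`), `submoduleMap_projectivization_injective`,
  **`ncard_setOf_span_singleton`** (`K` finite: their number is `Σ_{i ≤ r} |K|^i`).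
* §521 **`ncard_setOf_recSpace_self`** (`2r ≤ N + 1`, `K` finite: THE NUMBER OF MINIMAL-RECURRENCE LINES OF RANK-`r` CLASSES IS `Σ_{i ≤ r} |K|^i = |P^r(K)|`),
  `ncard_setOf_Kr_w_eq_ncard_setOf_recSpace_self` (every field: in the window the kernels of the rank-`r` classes are equinumerous with their minimal-recurrence lines),
  **`ncard_setOf_Kr_w`** (`r ≤ k`, `k + r ≤ N + 1`, `k ≤ N`, `K` finite: THE NUMBER OF DISTINCT DEGREE-`k` KERNELS OF RANK-`r` CLASSES IS `Σ_{i ≤ r} |K|^i`).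
READING: the census files (N16/N17) counted dimensions; this file counts the objects themselves over `F_s`: `|P^r(F_s)| = (s^{r+1} − 1)/(s − 1)` kernels per degree in the window,
independently of `k` and of `N` — gen-26 OPEN (ii).  Nothing Ext-side.  New names only.
-/

open Module Polynomial
open scoped Matrix Polynomial

namespace Summit.Ventures.HSemireg.Wedge.HankelOuter

open Summit.Ventures.HSemireg.Wedge Summit.Ventures.HSemireg.Wedge.Kunneth Summit.Ventures.HSemireg.Wedge.Hankel
  Summit.Ventures.HSemireg.Wedge.BasisFree Summit.Ventures.HSemireg.Wedge.HankelSiegel Summit.Ventures.HSemireg.Wedge.HankelSiegelIdeal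
  Summit.Ventures.HSemireg.Wedge.KunnethKernel Summit.Ventures.HSemireg.Wedge.HankelFrameChange Summit.Ventures.HSemireg.Wedge.KernelDuality

variable (K : Type*) [Field K] {N : ℕ}

/-! ## §520. The lines of `K[X]_{≤ r}` are the points of `P(K[X]_{≤ r})`, `Σ_{i ≤ r} |K|^i` of them over a finite field -/

/-- **the lines `K · p₀` (`p₀ ≠ 0`, `deg p₀ ≤ r`) are exactly the images in `K[X]` of the points of the projective space `P(K[X]_{≤ r})`.** -/
theorem setOf_span_singleton_eq_range (r : ℕ) :
    {L : Submodule K K[X] | ∃ p₀ : K[X], p₀ ≠ 0 ∧ p₀.natDegree ≤ r ∧ L = K ∙ p₀}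
      = Set.range (fun v : Projectivization K (Polynomial.degreeLT K (r + 1)) => v.submodule.map (Polynomial.degreeLT K (r + 1)).subtype) := by
  ext L
  constructor
  · rintro ⟨p₀, hp₀, hdeg, rfl⟩
    have hmem : p₀ ∈ Polynomial.degreeLT K (r + 1) := (mem_degreeLT_succ_iff K).mpr hdeg
    have hne : (⟨p₀, hmem⟩ : Polynomial.degreeLT K (r + 1)) ≠ 0 := fun h => hp₀ (congrArg Subtype.val h)
    refine ⟨Projectivization.mk K ⟨p₀, hmem⟩ hne, ?_⟩
    dsimp only
    rw [Projectivization.submodule_mk, Submodule.map_span, Submodule.coe_subtype, Set.image_singleton]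
  · rintro ⟨v, rfl⟩
    induction v using Projectivization.ind with
    | h u hu =>
      refine ⟨(u : K[X]), fun h => hu (Subtype.ext h), (mem_degreeLT_succ_iff K).mp u.2, ?_⟩
      dsimp only
      rw [Projectivization.submodule_mk, Submodule.map_span, Submodule.coe_subtype, Set.image_singleton]

/-- distinct points of `P(K[X]_{≤ r})` give distinct lines of `K[X]`. -/
theorem submoduleMap_projectivization_injective (r : ℕ) :
    Function.Injective (fun v : Projectivization K (Polynomial.degreeLT K (r + 1)) => v.submodule.map (Polynomial.degreeLT K (r + 1)).subtype) :=
  (Submodule.map_injective_of_injective (Polynomial.degreeLT K (r + 1)).injective_subtype).comp Projectivization.submodule_injective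

/-- **over a finite field there are `Σ_{i ≤ r} |K|^i = |P^r(K)|` lines `K · p₀` with `p₀ ≠ 0`, `deg p₀ ≤ r`.** -/
theorem ncard_setOf_span_singleton [Finite K] (r : ℕ) :
    {L : Submodule K K[X] | ∃ p₀ : K[X], p₀ ≠ 0 ∧ p₀.natDegree ≤ r ∧ L = K ∙ p₀}.ncard = ∑ i ∈ Finset.range (r + 1), Nat.card K ^ i := by
  rw [setOf_span_singleton_eq_range, Set.ncard_range_of_injective (submoduleMap_projectivization_injective K r),
    Projectivization.card_of_finrank K _ (finrank_polynomial_degreeLT K (r + 1))]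

/-! ## §521. Counting the minimal recurrences and the kernels of the rank-`r` classes -/

/-- **THE NUMBER OF MINIMAL-RECURRENCE LINES: over a finite field `K` and for `2r ≤ N + 1`, the classes `q` on `[0, N]` of middle rank `r` have exactly `Σ_{i ≤ r} |K|^i` distinct
minimal-recurrence lines `Rec_r(q)`** (N26: these lines are all of `P(K[X]_{≤ r})`). -/
theorem ncard_setOf_recSpace_self [Finite K] {r : ℕ} (h2r : r + r ≤ N + 1) :
    {L : Submodule K K[X] | ∃ q : ℕ → K, (hankel1 K N (N / 2) q).rank = r ∧ recSpace K N q r = L}.ncard = ∑ i ∈ Finset.range (r + 1), Nat.card K ^ i := by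
  rw [setOf_recSpace_self_eq K h2r, ncard_setOf_span_singleton]

/-- in the window `r ≤ k`, `k + r ≤ N + 1`, `k ≤ N` (every field): **the distinct degree-`k` kernels of the rank-`r` classes are equinumerous with their distinct minimal-recurrence lines**
(N27's Torelli `Kr(univ, w_N(q), k) = Kr(univ, w_N(q′), k) ↔ Rec_r(q) = Rec_r(q′)` makes `Rec_r(q) ↦ Kr(univ, w_N(q), k)` a well-defined bijection). -/
theorem ncard_setOf_Kr_w_eq_ncard_setOf_recSpace_self {r k : ℕ} (hrk : r ≤ k) (hkr : k + r ≤ N + 1) (hkN : k ≤ N) :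
    {M : Submodule K (HT K (In N)) | ∃ q : ℕ → K, (hankel1 K N (N / 2) q).rank = r ∧ Kr K (Finset.univ : Finset (In N)) (w K N N q) k = M}.ncard
      = {L : Submodule K K[X] | ∃ q : ℕ → K, (hankel1 K N (N / 2) q).rank = r ∧ recSpace K N q r = L}.ncard := by
  obtain ⟨d, rfl⟩ := Nat.exists_eq_add_of_le hrk
  have key : ∀ q q' : ℕ → K, (hankel1 K N (N / 2) q).rank = r → (hankel1 K N (N / 2) q').rank = r →
      (Kr K (Finset.univ : Finset (In N)) (w K N N q) (r + d) = Kr K (Finset.univ : Finset (In N)) (w K N N q') (r + d) ↔ recSpace K N q r = recSpace K N q' r) :=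
    fun q q' hq hq' => Kr_w_eq_Kr_w_iff_recSpace_self_eq K hq hq' (by omega) hkN
  symm
  refine Set.ncard_congr (fun L hL => Kr K (Finset.univ : Finset (In N)) (w K N N hL.choose) (r + d)) ?_ ?_ ?_
  · intro L hL
    exact ⟨hL.choose, hL.choose_spec.1, rfl⟩
  · intro L L' hL hL' h
    rw [← hL.choose_spec.2, ← hL'.choose_spec.2]
    exact (key _ _ hL.choose_spec.1 hL'.choose_spec.1).mp h
  · rintro M ⟨q, hq, rfl⟩
    have hL : ∃ q₀ : ℕ → K, (hankel1 K N (N / 2) q₀).rank = r ∧ recSpace K N q₀ r = recSpace K N q r := ⟨q, hq, rfl⟩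
    refine ⟨recSpace K N q r, hL, ?_⟩
    exact (key _ _ hL.choose_spec.1 hq).mpr hL.choose_spec.2

/-- **THE NUMBER OF KERNELS: over a finite field `K`, for `r ≤ k`, `k + r ≤ N + 1`, `k ≤ N`, the classes of middle rank `r` have exactly `Σ_{i ≤ r} |K|^i = |P^r(K)|` distinct
degree-`k` kernels `Kr(univ, w_N(q), k)`** — the same number in every degree of the window and for every `N`. -/
theorem ncard_setOf_Kr_w [Finite K] {r k : ℕ} (hrk : r ≤ k) (hkr : k + r ≤ N + 1) (hkN : k ≤ N) :
    {M : Submodule K (HT K (In N)) | ∃ q : ℕ → K, (hankel1 K N (N / 2) q).rank = r ∧ Kr K (Finset.univ : Finset (In N)) (w K N N q) k = M}.ncard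
      = ∑ i ∈ Finset.range (r + 1), Nat.card K ^ i := by
  rw [ncard_setOf_Kr_w_eq_ncard_setOf_recSpace_self K hrk hkr hkN, ncard_setOf_recSpace_self K (by omega)]

end Summit.Ventures.HSemireg.Wedge.HankelOuter
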